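import Literature.Analysis.FluidPDE.LeslieShvydkoy2018DyadicEnergy
import Literature.Analysis.FluidPDE.LocalPressureOscillationScaling
import Literature.Analysis.FluidPDE.NormalisedPressureLpClass
import Mathlib.Analysis.MeanInequalitiesPow
import HarnessLib

/-!
# Leslie–Shvydkoy 2018, Prop. 3.2: the pressure term of Lemma 3.6 on one time slice

Analysis/FluidPDE proofs file (theorems only; no definitions, no named facts) on the discharge
path of the named fact `Literature.Analysis.FluidPDE.leslieShvydkoy2018_morreyBound`
(`LeslieShvydkoy2018MorreyBound.lean`; T. M. Leslie, R. Shvydkoy, ARMA 230 (2018) =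
arXiv:1705.04420, Prop. 3.2 + 4.2). It renders the pressure half of the printed proof of
**Lemma 3.6** (p. 11): for a velocity slice `v ∈ L² ∩ L^∞(ℝ³)` with `‖v‖ ≤ F` (the printed
`f(τ) = ‖u(τ)‖_{L^∞}`) and a pressure `P ∈ L^{3/2}(ℝ³)` solving the pressure Poisson equation
`-ΔP = ∂ᵢ∂ⱼ(vᵢvⱼ)` in `𝒟'(ℝ³)` (in print `p = RᵢRⱼ(uᵢuⱼ)`; on the tree's frame the normalised
pressure `normalisedPressure v`, to which the classical pressure is gauged at a.e. time),

> "Take `ρ → ∞` in the local pressure inequality (3.16); the last term tends to zero because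
> `u ∈ L³(-1,0; L³(ℝⁿ))`.
> `‖p - (p)_r‖_{L^{3/2}(B_r)} ≤ c‖u‖²_{L³(B_{2r})} + c r^{2n/3+1} ∫_{2r<|y|<∞} |u|²|y|^{-n-1} dy.` (3.17)
> As before, we split the remaining integral into dyadic shells … `≤ C r^{-n/3} Σ_j 2^{-j} E_j`.
> … `‖u(τ)‖_{L³(B_r)} ≤ C f(τ)^{1/3} E(τ,2r)^{1/3} ≤ C f(τ) r^{n/3}`. Therefore
> `‖p - (p)_r‖_{L^{3/2}(B_r)} ‖u‖_{L³(B_r)} ≤ C f(τ) Σ_j 2^{-j} E_j(τ, r)`."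

with the dyadic sum replaced by the supremum `W_r(v) = dyadicEnergySup v x₀ r` of
`LeslieShvydkoy2018DyadicEnergy.lean` (`Σ_j 2^{-j} E_j ≤ sup_j E_j`). The local pressure
inequality (3.16) is the tree's proved Robinson–Rodrigo–Sadowski Lemma 15.12 on one slice
(`setLIntegral_pressure_oscillation_le`, `LocalPressureOscillationScaling.lean`); the limit
`ρ → ∞` uses `P ∈ L^{3/2}(ℝ³)`, `v ∈ L³(ℝ³)`.

* `memLp_three_of_memLp_two_of_norm_le` — `L² ∩ L^∞ ⊂ L³` for the slice;
* `memLp_normalisedPressure_threeHalves`, `integral_normalisedPressure_mul_laplacian_threeHalves`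
  — the normalised pressure of such a slice is in `L^{3/2}` and solves the Poisson equation
  (the tree's Stein bound `memLp_normalisedPressure_of_memLp_two_mul` and
  `integral_normalisedPressure_mul_laplacian_of_memLp`, `NormalisedPressureLpClass.lean`);
* `exists_setLIntegral_pressure_oscillation_le_shell` — **(3.17)**: the oscillation estimate with
  `ρ = ∞` (full exterior shell, no tail term);
* `exists_lintegral_pressure_oscillation_mul_velocity_le` — **the pressure term of Lemma 3.6**:
  `∫_{B(x₀,r)} |P - (P)_r| |v| ≤ C F W_r(v)` with an absolute constant `C`.

## References

* T. M. Leslie, R. Shvydkoy, ARMA 230 (2018) = arXiv:1705.04420, §3.4, proof of Lemma 3.6,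
  (3.16)–(3.17) (p. 11). [`LeslieShvydkoy2017`]
* J. C. Robinson, J. L. Rodrigo, W. Sadowski, *The three-dimensional Navier–Stokes equations*
  (2016), Lemma 15.12 (the local pressure inequality cited as [RRS] in the paper).
  [`RobinsonRodrigoSadowski2016`]
-/

noncomputable section

open MeasureTheory Set Metric Filter Function
open scoped ENNReal NNReal Topology Laplacian

namespace Literature.Analysis.FluidPDE

namespace LeslieShvydkoy2018

variable {v : EuclideanSpace ℝ (Fin 3) → EuclideanSpace ℝ (Fin 3)} {x₀ : EuclideanSpace ℝ (Fin 3)}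
  {F r : ℝ}

/-! ### The slice class `L² ∩ L^∞ ⊂ L³` -/

/-- `(3/2 : ℝ≥0∞).toReal = 3/2`. [folklore] -/
private theorem toReal_threeHalves : (3 / 2 : ℝ≥0∞).toReal = 3 / 2 := by
  rw [ENNReal.toReal_div]; norm_num

/-- `1 < 3/2 < ∞` in `ℝ≥0∞`. [folklore] -/
private theorem one_lt_threeHalves : (1 : ℝ≥0∞) < 3 / 2 := by
  rw [ENNReal.lt_div_iff_mul_lt (Or.inl (by norm_num)) (Or.inl (by norm_num))]; norm_num

/-- `3/2 < ∞` in `ℝ≥0∞`. [folklore] -/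
private theorem threeHalves_lt_top : (3 / 2 : ℝ≥0∞) < ⊤ :=
  ENNReal.div_lt_top (by norm_num) (by norm_num)

/-- `2 · (3/2) = 3` in `ℝ≥0∞`. [folklore] -/
private theorem two_mul_threeHalves : (2 : ℝ≥0∞) * (3 / 2) = 3 :=
  ENNReal.mul_div_cancel (by norm_num) (by norm_num)

/-- **`L² ∩ L^∞ ⊂ L³`**: a square-integrable slice with `‖v‖ ≤ F` is in `L³`
(`∫|v|³ ≤ F ∫|v|²`; Claim 3.4 of the paper in the bounded case).
[cite: LeslieShvydkoy2017, Claim 3.4 (p. 9)] -/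
theorem memLp_three_of_memLp_two_of_norm_le (hv : MemLp v 2 volume) (hF : ∀ y, ‖v y‖ ≤ F) :
    MemLp v 3 volume := by
  refine ⟨hv.1, ?_⟩
  rw [eLpNorm_lt_top_iff_lintegral_rpow_enorm_lt_top (by norm_num) (by norm_num)]
  have h2 := lintegral_rpow_enorm_lt_top_of_eLpNorm_lt_top (by norm_num) (by norm_num) hv.2
  simp only [ENNReal.toReal_ofNat] at h2 ⊢
  have h3 : ∫⁻ y, ‖v y‖ₑ ^ (3 : ℝ) ≤ ENNReal.ofReal F * ∫⁻ y, ‖v y‖ₑ ^ (2 : ℝ) := by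
    have h := lintegral_enorm_cube_le_of_norm_le (v := v) hF univ
    simp only [Measure.restrict_univ] at h
    have e3 : ∀ y, ‖v y‖ₑ ^ (3 : ℝ) = ‖v y‖ₑ ^ (3 : ℕ) := fun y => by
      rw [← ENNReal.rpow_natCast]; norm_num
    have e2 : ∀ y, ‖v y‖ₑ ^ (2 : ℝ) = ‖v y‖ₑ ^ (2 : ℕ) := fun y => by
      rw [← ENNReal.rpow_natCast]; norm_num
    simp_rw [e3, e2]
    exact h
  exact h3.trans_lt (ENNReal.mul_lt_top ENNReal.ofReal_lt_top h2)

/-- `∫ |v|³ < ∞` (natural power) for `v ∈ L³`. [folklore] -/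
private theorem lintegral_enorm_pow_three_lt_top (hv3 : MemLp v 3 volume) :
    ∫⁻ y, ‖v y‖ₑ ^ (3 : ℕ) < ⊤ := by
  have h := lintegral_rpow_enorm_lt_top_of_eLpNorm_lt_top (by norm_num) (by norm_num) hv3.2
  simp only [ENNReal.toReal_ofNat] at h
  have e3 : ∀ y, ‖v y‖ₑ ^ (3 : ℕ) = ‖v y‖ₑ ^ (3 : ℝ) := fun y => by
    rw [← ENNReal.rpow_natCast]; norm_num
  simp_rw [e3]
  exact h

/-- `∫ |P|^{3/2} < ∞` for `P ∈ L^{3/2}`. [folklore] -/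
private theorem lintegral_enorm_rpow_threeHalves_lt_top {P : EuclideanSpace ℝ (Fin 3) → ℝ}
    (hP : MemLp P (3 / 2) volume) : ∫⁻ y, ‖P y‖ₑ ^ (3 / 2 : ℝ) < ⊤ := by
  have h := lintegral_rpow_enorm_lt_top_of_eLpNorm_lt_top (by norm_num) threeHalves_lt_top.ne
    hP.2
  rwa [toReal_threeHalves] at h

/-! ### The normalised pressure of the slice -/

/-- **The normalised pressure of a slice `v ∈ L² ∩ L^∞` is in `L^{3/2}(ℝ³)`** (Stein's bound
`‖RᵢRⱼ(vᵢvⱼ)‖_{3/2} ≲ ‖v‖₃²`; in print Claim 3.4, "we can use the boundedness of the Riesz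
transforms on `L^{3/2}`"). [cite: LeslieShvydkoy2017, Claim 3.4 (p. 9)] -/
theorem memLp_normalisedPressure_threeHalves (hv : MemLp v 2 volume) (hF : ∀ y, ‖v y‖ ≤ F) :
    MemLp (normalisedPressure v) (3 / 2) volume := by
  have hv3 : MemLp v (2 * (3 / 2)) volume := by
    rw [two_mul_threeHalves]; exact memLp_three_of_memLp_two_of_norm_le hv hF
  exact memLp_normalisedPressure_of_memLp_two_mul one_lt_threeHalves threeHalves_lt_top hv3

/-- **The pressure Poisson equation** `∫ p̃[v] Δθ = -∫ D²θ(v,v)` for every test function `θ`,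
for a slice `v ∈ L² ∩ L^∞` (Tsai's approximation argument on the class `v ∈ L³`, the tree's
`integral_normalisedPressure_mul_laplacian_of_memLp`). [cite: LeslieShvydkoy2017, §1 `p = RᵢRⱼ(uᵢuⱼ)` (p. 3) and Lemma 3.5 hypothesis (p. 10)] -/
theorem integral_normalisedPressure_mul_laplacian_threeHalves (hv : MemLp v 2 volume)
    (hF : ∀ y, ‖v y‖ ≤ F) {θ : EuclideanSpace ℝ (Fin 3) → ℝ} (hθ : ContDiff ℝ (⊤ : ℕ∞) θ)
    (hθc : HasCompactSupport θ) :
    ∫ x, normalisedPressure v x * (Δ θ) x = -∫ x, fderiv ℝ (fderiv ℝ θ) x (v x) (v x) := by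
  have hv3 : MemLp v (2 * (3 / 2)) volume := by
    rw [two_mul_threeHalves]; exact memLp_three_of_memLp_two_of_norm_le hv hF
  exact integral_normalisedPressure_mul_laplacian_of_memLp one_lt_threeHalves threeHalves_lt_top
    hv3 hθ hθc

/-! ### (3.17): the oscillation estimate with the full exterior shell -/

/-- **Leslie–Shvydkoy (3.17)** ("Take `ρ → ∞` in the local pressure inequality; the last term
tends to zero because `u ∈ L³`"). There is an absolute `C` such that for `v ∈ L³(ℝ³)`,
`P ∈ L^{3/2}(ℝ³)` with `-ΔP = ∂ᵢ∂ⱼ(vᵢvⱼ)` in `𝒟'(ℝ³)`, every centre `x₀` and radius `r > 0`: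
`∫_{B(x₀,r)} |P - (P)_r|^{3/2} ≤ C [∫_{B(x₀,2r)} |v|³ + r^{9/2} (∫_{|y-x₀|>2r} |v|²|y-x₀|⁻⁴)^{3/2}]`.
[cite: LeslieShvydkoy2017, §3.4 (3.17) (p. 11); RobinsonRodrigoSadowski2016, Lemma 15.12] -/
theorem exists_setLIntegral_pressure_oscillation_le_shell :
    ∃ C : ℝ≥0, ∀ (x₀ : EuclideanSpace ℝ (Fin 3)) (r : ℝ)
      (v : EuclideanSpace ℝ (Fin 3) → EuclideanSpace ℝ (Fin 3)) (P : EuclideanSpace ℝ (Fin 3) → ℝ),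
      0 < r → MemLp v 3 volume → MemLp P (3 / 2) volume →
      (∀ θ : EuclideanSpace ℝ (Fin 3) → ℝ, ContDiff ℝ (⊤ : ℕ∞) θ → HasCompactSupport θ →
        ∫ x, P x * (Δ θ) x = -∫ x, fderiv ℝ (fderiv ℝ θ) x (v x) (v x)) →
      ∫⁻ x in ball x₀ r, ‖P x - ⨍ y in ball x₀ r, P y‖ₑ ^ (3 / 2 : ℝ) ≤
        C * ((∫⁻ x in ball x₀ (2 * r), ‖v x‖ₑ ^ (3 : ℕ)) +
          ENNReal.ofReal (r ^ (9 / 2 : ℝ)) *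
            (∫⁻ y in {y | 2 * r < dist y x₀}, ‖v y‖ₑ ^ 2 / ENNReal.ofReal (dist y x₀ ^ 4)) ^
              (3 / 2 : ℝ)) := by
  obtain ⟨C, hC⟩ := setLIntegral_pressure_oscillation_le
  refine ⟨C, fun x₀ r v P hr hv3 hP hpoisson => ?_⟩
  -- the global quantities
  set K : ℝ≥0∞ := (∫⁻ x, ‖v x‖ₑ ^ (3 : ℕ)) + ∫⁻ x, ‖P x‖ₑ ^ (3 / 2 : ℝ) with hK
  have hKtop : K ≠ ⊤ := (ENNReal.add_lt_top.2
    ⟨lintegral_enorm_pow_three_lt_top hv3, lintegral_enorm_rpow_threeHalves_lt_top hP⟩).ne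
  set A : ℝ≥0∞ := ∫⁻ x in ball x₀ (2 * r), ‖v x‖ₑ ^ (3 : ℕ) with hA
  set S : ℝ≥0∞ := ∫⁻ y in {y | 2 * r < dist y x₀},
    ‖v y‖ₑ ^ 2 / ENNReal.ofReal (dist y x₀ ^ 4) with hS
  set L : ℝ≥0∞ := ∫⁻ x in ball x₀ r, ‖P x - ⨍ y in ball x₀ r, P y‖ₑ ^ (3 / 2 : ℝ) with hL
  -- the estimate at every finite `ρ ≥ 2r`
  have hρ : ∀ ρ : ℝ, 2 * r ≤ ρ →
      L ≤ C * (A + ENNReal.ofReal (r ^ (9 / 2 : ℝ)) * S ^ (3 / 2 : ℝ)) +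
        C * ENNReal.ofReal (r ^ (9 / 2 : ℝ) / ρ ^ (9 / 2 : ℝ)) * K := by
    intro ρ hρ
    have hρ0 : 0 < ρ := by linarith
    have h := hC x₀ ρ r P v hρ0 hr (by linarith) hP.1.restrict hv3.1.restrict
      ((setLIntegral_le_lintegral _ _).trans_lt (lintegral_enorm_rpow_threeHalves_lt_top hP))
      ((setLIntegral_le_lintegral _ _).trans_lt (lintegral_enorm_pow_three_lt_top hv3))
      (fun θ hθ hθc _ => hpoisson θ hθ hθc)
    refine h.trans ?_
    have hshell : (∫⁻ y in {y | 2 * r < dist y x₀ ∧ dist y x₀ < ρ},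
        ‖v y‖ₑ ^ 2 / ENNReal.ofReal (dist y x₀ ^ 4)) ≤ S :=
      lintegral_mono_set fun y hy => hy.1
    have htail : (∫⁻ x in ball x₀ ρ, (‖v x‖ₑ ^ (3 : ℕ) + ‖P x‖ₑ ^ (3 / 2 : ℝ))) ≤ K := by
      calc (∫⁻ x in ball x₀ ρ, (‖v x‖ₑ ^ (3 : ℕ) + ‖P x‖ₑ ^ (3 / 2 : ℝ)))
          ≤ ∫⁻ x, (‖v x‖ₑ ^ (3 : ℕ) + ‖P x‖ₑ ^ (3 / 2 : ℝ)) := setLIntegral_le_lintegral _ _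
        _ = K := by rw [hK, lintegral_add_left' (hv3.1.enorm.pow_const _)]
    calc C * (A + ENNReal.ofReal (r ^ (9 / 2 : ℝ)) *
          (∫⁻ y in {y | 2 * r < dist y x₀ ∧ dist y x₀ < ρ},
            ‖v y‖ₑ ^ 2 / ENNReal.ofReal (dist y x₀ ^ 4)) ^ (3 / 2 : ℝ) +
          ENNReal.ofReal (r ^ (9 / 2 : ℝ) / ρ ^ (9 / 2 : ℝ)) *
            ∫⁻ x in ball x₀ ρ, (‖v x‖ₑ ^ (3 : ℕ) + ‖P x‖ₑ ^ (3 / 2 : ℝ)))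
        ≤ C * (A + ENNReal.ofReal (r ^ (9 / 2 : ℝ)) * S ^ (3 / 2 : ℝ) +
          ENNReal.ofReal (r ^ (9 / 2 : ℝ) / ρ ^ (9 / 2 : ℝ)) * K) := by
          gcongr
      _ = _ := by ring
  -- `ρ → ∞`: the tail constant tends to `0`
  have htend : Tendsto (fun ρ : ℝ => C * ENNReal.ofReal (r ^ (9 / 2 : ℝ) / ρ ^ (9 / 2 : ℝ)) * K)
      atTop (𝓝 0) := by
    have h1 : Tendsto (fun ρ : ℝ => r ^ (9 / 2 : ℝ) / ρ ^ (9 / 2 : ℝ)) atTop (𝓝 0) := by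
      have := (tendsto_rpow_atTop (by norm_num : (0 : ℝ) < 9 / 2)).inv_tendsto_atTop.const_mul
        (r ^ (9 / 2 : ℝ))
      simpa [div_eq_mul_inv] using this
    have h2 : Tendsto (fun ρ : ℝ => ENNReal.ofReal (r ^ (9 / 2 : ℝ) / ρ ^ (9 / 2 : ℝ))) atTop
        (𝓝 0) := by
      simpa using ENNReal.tendsto_ofReal h1
    have h3 : Tendsto (fun ρ : ℝ => (C : ℝ≥0∞) * ENNReal.ofReal (r ^ (9 / 2 : ℝ) / ρ ^ (9 / 2 : ℝ)))
        atTop (𝓝 0) := by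
      simpa using ENNReal.Tendsto.const_mul h2 (Or.inr ENNReal.coe_ne_top)
    simpa using ENNReal.Tendsto.mul_const h3 (Or.inr hKtop)
  refine ENNReal.le_of_forall_pos_le_add fun ε hε _ => ?_
  have hev : ∀ᶠ ρ : ℝ in atTop,
      C * ENNReal.ofReal (r ^ (9 / 2 : ℝ) / ρ ^ (9 / 2 : ℝ)) * K ≤ (ε : ℝ≥0∞) :=
    htend (Iic_mem_nhds (by exact_mod_cast hε))
  obtain ⟨ρ, hρ2, hρε⟩ := (hev.and (eventually_ge_atTop (2 * r))).exists
  exact (hρ ρ hρε).trans (add_le_add le_rfl hρ2)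

/-! ### The pressure term of Lemma 3.6 -/

/-- Hölder on a ball with exponents `3/2`, `3`: `∫_B |G| |v| ≤ (∫_B |G|^{3/2})^{2/3} (∫_B |v|³)^{1/3}`.
[folklore] -/
private theorem lintegral_ball_mul_le_holder {G : EuclideanSpace ℝ (Fin 3) → ℝ}
    (hG : AEStronglyMeasurable G volume) (hv : AEStronglyMeasurable v volume)
    (B : Set (EuclideanSpace ℝ (Fin 3))) :
    ∫⁻ y in B, ‖G y‖ₑ * ‖v y‖ₑ ≤
      (∫⁻ y in B, ‖G y‖ₑ ^ (3 / 2 : ℝ)) ^ (2 / 3 : ℝ) * (∫⁻ y in B, ‖v y‖ₑ ^ (3 : ℕ)) ^ (1 / 3 : ℝ) := by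
  have hpq : (3 / 2 : ℝ).HolderConjugate 3 := by rw [Real.holderConjugate_iff]; norm_num
  have h := ENNReal.lintegral_mul_le_Lp_mul_Lq (volume.restrict B) hpq
    hG.enorm.restrict hv.enorm.restrict
  have e1 : (1 : ℝ) / (3 / 2) = 2 / 3 := by norm_num
  have e3 : ∀ y, ‖v y‖ₑ ^ (3 : ℝ) = ‖v y‖ₑ ^ (3 : ℕ) := fun y => by
    rw [← ENNReal.rpow_natCast]; norm_num
  simp only [Pi.mul_apply, e1, e3] at h
  exact h

/-- Elementary `ℝ≥0∞` algebra of the final step: if `L ≤ c₁ Φ W + c₂ ρ W^{3/2}` (`ρ = r^{-3/2}`),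
`Y ≤ Φ W` and `Y ≤ σ³ W⁰`-free bound `Y ≤ (Φ μ)³` with `ρ^{2/3} μ = ν` constant, then
`L^{2/3} Y^{1/3} ≤ (c₁^{2/3} + c₂^{2/3} ν) Φ W`. Stated with the concrete shapes used below.
[folklore] -/
private theorem rpow_twoThirds_mul_rpow_third_le {L Y Φ W X₁ X₂ M : ℝ≥0∞}
    (hL : L ≤ X₁ + X₂) (hX₁ : X₁ ^ (2 / 3 : ℝ) ≤ M * (Φ * W) ^ (2 / 3 : ℝ))
    {N : ℝ≥0∞} (hX₂Y : X₂ ^ (2 / 3 : ℝ) * Y ^ (1 / 3 : ℝ) ≤ N * (Φ * W))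
    (hY : Y ≤ Φ * W) :
    L ^ (2 / 3 : ℝ) * Y ^ (1 / 3 : ℝ) ≤ (M + N) * (Φ * W) := by
  have h23 : (0 : ℝ) ≤ 2 / 3 := by norm_num
  have h13 : (0 : ℝ) ≤ 1 / 3 := by norm_num
  calc L ^ (2 / 3 : ℝ) * Y ^ (1 / 3 : ℝ)
      ≤ (X₁ + X₂) ^ (2 / 3 : ℝ) * Y ^ (1 / 3 : ℝ) := by gcongr
    _ ≤ (X₁ ^ (2 / 3 : ℝ) + X₂ ^ (2 / 3 : ℝ)) * Y ^ (1 / 3 : ℝ) := by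
        gcongr; exact ENNReal.rpow_add_le_add_rpow _ _ h23 (by norm_num)
    _ = X₁ ^ (2 / 3 : ℝ) * Y ^ (1 / 3 : ℝ) + X₂ ^ (2 / 3 : ℝ) * Y ^ (1 / 3 : ℝ) := add_mul _ _ _
    _ ≤ M * (Φ * W) ^ (2 / 3 : ℝ) * (Φ * W) ^ (1 / 3 : ℝ) + N * (Φ * W) := by
        gcongr
    _ = M * (Φ * W) + N * (Φ * W) := by
        rw [mul_assoc, ← ENNReal.rpow_add_of_nonneg _ _ h23 h13]
        norm_num
    _ = (M + N) * (Φ * W) := (add_mul _ _ _).symm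

/-- **The pressure term of Lemma 3.6** (Leslie–Shvydkoy 2018, p. 11: "`‖p - (p)_r‖_{L^{3/2}(B_r)}
‖u‖_{L³(B_r)} ≤ C f(τ) Σ_j 2^{-j} E_j(τ, r)`", with the dyadic sum dominated by the supremum
`W_r`). There is an absolute constant `C` such that for every slice `v ∈ L²(ℝ³)` with `‖v‖ ≤ F`,
every `P ∈ L^{3/2}(ℝ³)` solving `-ΔP = ∂ᵢ∂ⱼ(vᵢvⱼ)` in `𝒟'(ℝ³)`, every `x₀` and `r > 0`:
`∫_{B(x₀,r)} |P - (P)_{B(x₀,r)}| |v| ≤ C F W_r(v)`.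
[cite: LeslieShvydkoy2017, §3.4, proof of Lemma 3.6, (3.17) and the three displays after it (p. 11)] -/
theorem exists_lintegral_pressure_oscillation_mul_velocity_le :
    ∃ C : ℝ≥0, ∀ (x₀ : EuclideanSpace ℝ (Fin 3)) (r F : ℝ)
      (v : EuclideanSpace ℝ (Fin 3) → EuclideanSpace ℝ (Fin 3)) (P : EuclideanSpace ℝ (Fin 3) → ℝ),
      0 < r → MemLp v 2 volume → (∀ y, ‖v y‖ ≤ F) → MemLp P (3 / 2) volume →
      (∀ θ : EuclideanSpace ℝ (Fin 3) → ℝ, ContDiff ℝ (⊤ : ℕ∞) θ → HasCompactSupport θ →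
        ∫ x, P x * (Δ θ) x = -∫ x, fderiv ℝ (fderiv ℝ θ) x (v x) (v x)) →
      ∫⁻ y in ball x₀ r, ‖P y - ⨍ z in ball x₀ r, P z‖ₑ * ‖v y‖ₑ ≤
        C * (ENNReal.ofReal F * dyadicEnergySup v x₀ r) := by
  obtain ⟨C₀, hC₀⟩ := exists_setLIntegral_pressure_oscillation_le_shell
  -- the unit-ball volume (finite)
  set V : ℝ≥0∞ := volume (ball (0 : EuclideanSpace ℝ (Fin 3)) 1) with hV
  have hVtop : V ≠ ⊤ := measure_ball_lt_top.ne
  -- the constant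
  refine ⟨((8 * (C₀ : ℝ≥0∞)) ^ (2 / 3 : ℝ) +
      ((C₀ : ℝ≥0∞) * ENNReal.ofReal ((8 : ℝ) ^ (3 / 2 : ℝ))) ^ (2 / 3 : ℝ) * V ^ (1 / 3 : ℝ)).toNNReal,
    fun x₀ r F v P hr hv hF hP hpoisson => ?_⟩
  have hF0 : 0 ≤ F := (norm_nonneg _).trans (hF x₀)
  have hv3 : MemLp v 3 volume := memLp_three_of_memLp_two_of_norm_le hv hF
  set W : ℝ≥0∞ := dyadicEnergySup v x₀ r with hW
  set Φ : ℝ≥0∞ := ENNReal.ofReal F with hΦ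
  set M : ℝ≥0∞ := (8 * (C₀ : ℝ≥0∞)) ^ (2 / 3 : ℝ) with hM
  set N : ℝ≥0∞ := ((C₀ : ℝ≥0∞) * ENNReal.ofReal ((8 : ℝ) ^ (3 / 2 : ℝ))) ^ (2 / 3 : ℝ) *
    V ^ (1 / 3 : ℝ) with hN
  have hMNtop : M + N ≠ ⊤ := by
    refine ENNReal.add_ne_top.2 ⟨?_, ?_⟩
    · exact ENNReal.rpow_ne_top_of_nonneg (by norm_num) (ENNReal.mul_ne_top (by norm_num)
        ENNReal.coe_ne_top)
    · exact ENNReal.mul_ne_top (ENNReal.rpow_ne_top_of_nonneg (by norm_num)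
        (ENNReal.mul_ne_top ENNReal.coe_ne_top ENNReal.ofReal_ne_top))
        (ENNReal.rpow_ne_top_of_nonneg (by norm_num) hVtop)
  rw [ENNReal.coe_toNNReal hMNtop]
  -- the oscillation bound (3.17) with the slice inequalities of `LeslieShvydkoy2018DyadicEnergy`
  set L : ℝ≥0∞ := ∫⁻ x in ball x₀ r, ‖P x - ⨍ y in ball x₀ r, P y‖ₑ ^ (3 / 2 : ℝ) with hL
  set Y : ℝ≥0∞ := ∫⁻ y in ball x₀ r, ‖v y‖ₑ ^ (3 : ℕ) with hY
  have hA : ∫⁻ x in ball x₀ (2 * r), ‖v x‖ₑ ^ (3 : ℕ) ≤ Φ * (8 * W) := by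
    refine (lintegral_enorm_cube_le_of_norm_le hF _).trans ?_
    gcongr
    simpa using ballEnergySq_le_pow_mul_dyadicEnergySup (v := v) (x₀ := x₀) (R := r) 1
  have hS : ∫⁻ y in {y | 2 * r < dist y x₀}, ‖v y‖ₑ ^ 2 / ENNReal.ofReal (dist y x₀ ^ 4) ≤
      ENNReal.ofReal (8 * (r ^ 4)⁻¹) * W := lintegral_shell_le_dyadicEnergySup hr
  set X₁ : ℝ≥0∞ := (8 * (C₀ : ℝ≥0∞)) * (Φ * W) with hX₁
  set X₂ : ℝ≥0∞ := ((C₀ : ℝ≥0∞) * ENNReal.ofReal ((8 : ℝ) ^ (3 / 2 : ℝ))) *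
    (ENNReal.ofReal (r⁻¹) ^ (3 / 2 : ℝ) * W ^ (3 / 2 : ℝ)) with hX₂
  have hLle : L ≤ X₁ + X₂ := by
    refine (hC₀ x₀ r v P hr hv3 hP hpoisson).trans ?_
    -- `r^{9/2} (8 r⁻⁴ W)^{3/2} = 8^{3/2} (r⁻¹)^{3/2} W^{3/2}`
    have hpow : ENNReal.ofReal (r ^ (9 / 2 : ℝ)) * (ENNReal.ofReal (8 * (r ^ 4)⁻¹) * W) ^ (3 / 2 : ℝ)
        = ENNReal.ofReal ((8 : ℝ) ^ (3 / 2 : ℝ)) * (ENNReal.ofReal (r⁻¹) ^ (3 / 2 : ℝ) * W ^ (3 / 2 : ℝ)) := by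
      have h32 : (0 : ℝ) ≤ 3 / 2 := by norm_num
      have e : r ^ (9 / 2 : ℝ) * (8 * (r ^ 4)⁻¹) ^ (3 / 2 : ℝ) =
          (8 : ℝ) ^ (3 / 2 : ℝ) * (r⁻¹) ^ (3 / 2 : ℝ) := by
        rw [Real.mul_rpow (by norm_num) (by positivity), Real.inv_rpow (by positivity),
          Real.inv_rpow hr.le, show ((r : ℝ) ^ 4) = r ^ (4 : ℝ) by norm_cast, ← Real.rpow_mul hr.le]
        have h6 : r ^ ((4 : ℝ) * (3 / 2)) = r ^ (9 / 2 : ℝ) * r ^ (3 / 2 : ℝ) := by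
          rw [← Real.rpow_add hr]; norm_num
        have h9 : 0 < r ^ (9 / 2 : ℝ) := Real.rpow_pos_of_pos hr _
        have h3 : 0 < r ^ (3 / 2 : ℝ) := Real.rpow_pos_of_pos hr _
        rw [h6]
        field_simp
      calc ENNReal.ofReal (r ^ (9 / 2 : ℝ)) * (ENNReal.ofReal (8 * (r ^ 4)⁻¹) * W) ^ (3 / 2 : ℝ)
          = ENNReal.ofReal (r ^ (9 / 2 : ℝ)) *
              (ENNReal.ofReal (8 * (r ^ 4)⁻¹) ^ (3 / 2 : ℝ) * W ^ (3 / 2 : ℝ)) := by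
            rw [ENNReal.mul_rpow_of_nonneg _ _ h32]
        _ = ENNReal.ofReal (r ^ (9 / 2 : ℝ) * (8 * (r ^ 4)⁻¹) ^ (3 / 2 : ℝ)) * W ^ (3 / 2 : ℝ) := by
            rw [ENNReal.ofReal_rpow_of_nonneg (by positivity) h32, ← mul_assoc,
              ← ENNReal.ofReal_mul (by positivity)]
        _ = ENNReal.ofReal ((8 : ℝ) ^ (3 / 2 : ℝ) * (r⁻¹) ^ (3 / 2 : ℝ)) * W ^ (3 / 2 : ℝ) := by
            rw [e]
        _ = _ := by
            rw [ENNReal.ofReal_mul (by positivity), ← ENNReal.ofReal_rpow_of_nonneg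
              (inv_nonneg.2 hr.le) h32, mul_assoc]
    calc (C₀ : ℝ≥0∞) * ((∫⁻ x in ball x₀ (2 * r), ‖v x‖ₑ ^ (3 : ℕ)) +
          ENNReal.ofReal (r ^ (9 / 2 : ℝ)) *
            (∫⁻ y in {y | 2 * r < dist y x₀}, ‖v y‖ₑ ^ 2 / ENNReal.ofReal (dist y x₀ ^ 4)) ^
              (3 / 2 : ℝ))
        ≤ (C₀ : ℝ≥0∞) * (Φ * (8 * W) +
          ENNReal.ofReal (r ^ (9 / 2 : ℝ)) * (ENNReal.ofReal (8 * (r ^ 4)⁻¹) * W) ^ (3 / 2 : ℝ)) := by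
          gcongr
      _ = X₁ + X₂ := by rw [hpow, hX₁, hX₂]; ring
  -- the two cubic bounds on `B(x₀, r)`
  have hY₁ : Y ≤ Φ * W :=
    (lintegral_enorm_cube_le_of_norm_le hF _).trans (by gcongr; exact ballEnergySq_le_dyadicEnergySup)
  have hY₂ : Y ≤ ENNReal.ofReal (F ^ 3 * r ^ 3) * V := lintegral_ball_enorm_cube_le_of_norm_le hF hr.le
  -- the algebra
  have h23 : (0 : ℝ) ≤ 2 / 3 := by norm_num
  have h13 : (0 : ℝ) ≤ 1 / 3 := by norm_num
  have hX₁' : X₁ ^ (2 / 3 : ℝ) ≤ M * (Φ * W) ^ (2 / 3 : ℝ) := by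
    rw [hX₁, ENNReal.mul_rpow_of_nonneg _ _ h23]
  have hX₂Y : X₂ ^ (2 / 3 : ℝ) * Y ^ (1 / 3 : ℝ) ≤ N * (Φ * W) := by
    -- `X₂^{2/3} = (C₀ 8^{3/2})^{2/3} r⁻¹ W`, `Y^{1/3} ≤ F r V^{1/3}`
    have e1 : (ENNReal.ofReal (r⁻¹) ^ (3 / 2 : ℝ) * W ^ (3 / 2 : ℝ)) ^ (2 / 3 : ℝ) =
        ENNReal.ofReal (r⁻¹) * W := by
      rw [ENNReal.mul_rpow_of_nonneg _ _ h23, ← ENNReal.rpow_mul, ← ENNReal.rpow_mul]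
      norm_num
    have e2 : (ENNReal.ofReal (F ^ 3 * r ^ 3) * V) ^ (1 / 3 : ℝ) =
        ENNReal.ofReal (F * r) * V ^ (1 / 3 : ℝ) := by
      rw [ENNReal.mul_rpow_of_nonneg _ _ h13, show F ^ 3 * r ^ 3 = (F * r) ^ (3 : ℕ) by ring,
        ENNReal.ofReal_pow (mul_nonneg hF0 hr.le), ← ENNReal.rpow_natCast,
        ← ENNReal.rpow_mul]
      norm_num
    calc X₂ ^ (2 / 3 : ℝ) * Y ^ (1 / 3 : ℝ)
        ≤ X₂ ^ (2 / 3 : ℝ) * (ENNReal.ofReal (F ^ 3 * r ^ 3) * V) ^ (1 / 3 : ℝ) := by gcongr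
      _ = ((C₀ : ℝ≥0∞) * ENNReal.ofReal ((8 : ℝ) ^ (3 / 2 : ℝ))) ^ (2 / 3 : ℝ) *
            (ENNReal.ofReal (r⁻¹) * W) * (ENNReal.ofReal (F * r) * V ^ (1 / 3 : ℝ)) := by
          rw [hX₂, ENNReal.mul_rpow_of_nonneg _ _ h23, e1, e2]
      _ = N * (ENNReal.ofReal (r⁻¹) * ENNReal.ofReal (F * r)) * W := by rw [hN]; ring
      _ = N * (Φ * W) := by
          rw [← ENNReal.ofReal_mul (inv_nonneg.2 hr.le), show r⁻¹ * (F * r) = F by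
            field_simp, hΦ, mul_assoc]
  -- Hölder and conclusion
  calc ∫⁻ y in ball x₀ r, ‖P y - ⨍ z in ball x₀ r, P z‖ₑ * ‖v y‖ₑ
      ≤ L ^ (2 / 3 : ℝ) * Y ^ (1 / 3 : ℝ) :=
        lintegral_ball_mul_le_holder (hP.1.sub aestronglyMeasurable_const) hv.1 _
    _ ≤ (M + N) * (Φ * W) := rpow_twoThirds_mul_rpow_third_le hLle hX₁' hX₂Y hY₁

end LeslieShvydkoy2018

end Literature.Analysis.FluidPDE

end
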